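import Literature.Barriers.ValiantsHypothesis.BIJL18TPhiCompletionRankProofs
import Literature.Barriers.ValiantsHypothesis.BIJL18TPhiRankCore
import HarnessLib

/-!
# Bläser–Ikenmeyer–Jindal–Lysikov 2018, Lemma 22 — the safe reading, PROVED:
`CR(T_φ) ≥ 5s` for every 3-CNF `φ`, and `CR(T_φ) ≤ 5s ⇔ φ` is satisfiable

Sibling proofs file of `BIJL18MatrixCompletion.lean` (val-lit row BIJL2018-A; M. Bläser,
C. Ikenmeyer, G. Jindal, V. Lysikov, *Generalized matrix completion and algebraic natural proofs*,
STOC 2018 / ECCC TR18-064, §5, Lemma 22). The typed Lemma 22 is refuted as printed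
(`not_BIJL2018_lemma22`, `BIJL18TPhiCompletionRankProofs.lean`: part (2)'s `ε`-gap fails for
general 3-CNF because `CR(T_φ) ≤ 5s + t`). What the printed ingredients DO prove (ECCC p.16:
"From every clause gadget, the local columns 1, 3, 5, 8, and 9 are linearly independent … even if
we remove the local rows 1, 3, and 5"; Lemma 21 (2): rank five forces `u = x, v = y, w = z` and a
satisfied literal) is the exact reduction

* `five_mul_length_le_completionRank_tphi` — **(2′a)** `5s ≤ CR(T_φ)` for every `φ`;
* `exists_satisfying_of_completionRank_tphi_le` — **(2′b)** `CR(T_φ) ≤ 5s ⇒ φ` satisfiable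
  (an assignment with `numSat₃ φ σ = s`, the shape part (1) consumes);
* `completionRank_tphi_le_iff_satisfiable`, `completionRank_tphi_eq_iff_satisfiable` — with
  part (1) (`completionRank_tphi_le_of_satisfiable`, val-lit p2): `CR(T_φ) ≤ 5s ⇔ CR(T_φ) = 5s ⇔
  φ` satisfiable; `five_mul_length_lt_completionRank_tphi_of_unsat`: unsatisfiable `⇒ CR ≥ 5s + 1`;
* `BIJL2018_lemma22_safe_holds` — the named fact `BIJL2018_lemma22_safe` (statement file)
  DISCHARGED by the above;
* `Lemma22Safe.pencil_row_varCol`, `pencil_row_clauseRow0/1/2`, `pencil_varRow_varRow`,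
  `pencil_varRow_clauseRow`, `pencil_varRow_varCol`, `pencil_varRow_varCol_eq_zero` — the row
  shapes and the column support of the pencil at an arbitrary point (public, for the
  bounded-occurrence repair of part (2), val-lit p2).

Proof: the row shapes of the pencil `A₀ + Σ_k c_k A_k` of `T_φ` at an ARBITRARY point `c`
(local-variable rows and clause rows are those of the `9 × 9` gadget; the variable rows carry
arbitrary coupling entries from the formula-variable and auxiliary slices, including in-block ones
when a clause repeats a variable) are computed from the closed forms of
`BIJL18TPhiCompletionRankProofs.lean` (`Lemma22.svar_apply`, `Lemma22.sloc_apply`,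
`Lemma22.tphiSlices_aux_apply`) and fed to the abstract rank core `BIJL18TPhiRankCore.lean`
(`tphiCore_five_mul_le_rank`: a unitriangular `5s`-minor; `tphiCore_of_rank_le`: `rk ≤ 5s`
forces `u = x`, `v = y`, `w = z` and `(1−ℓ(x))(1−ℓ(y))(1−ℓ(z)) = 0` in every block, WITHOUT the
printed proof's assumption that the couplings vanish); `1 − ℓ(x) = 0` makes `x ∈ {0,1}` satisfy its
literal (`Lemma21.satisfiesLit_of_sub_gl_eq_zero`, val-lit p3), so `σ(v) := [c_v = 1]` satisfies
every clause. Theorem-only file (no definitions). HONEST FRAMING: typed literature about an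
NP-hardness gadget; `VP ≠ VNP` is NOT proved and nothing here is progress on it.

## References
* [BlaserIkenmeyerJindalLysikov2018] §5: construction of `T_φ` (ECCC pp.14–16), Lemma 21,
  Lemma 22 and its printed proof (p.16).
-/

noncomputable section

namespace Literature.Barriers.ValiantsHypothesis

open Matrix Literature.Computability.Complexity

universe u

variable {K : Type u} [Field K]

namespace Lemma22Safe

variable {t : ℕ}

/-! ### Index bookkeeping on the local indices `Fin 9` -/

/-- `∃` over `Fin 3`, spelled out. [folklore] -/
private theorem exists_fin3 {P : Fin 3 → Prop} : (∃ a, P a) ↔ P 0 ∨ P 1 ∨ P 2 := by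
  constructor
  · rintro ⟨a, ha⟩
    fin_cases a
    · exact Or.inl ha
    · exact Or.inr (Or.inl ha)
    · exact Or.inr (Or.inr ha)
  · rintro (h | h | h) <;> exact ⟨_, h⟩

/-- Local-variable rows are not variable rows. [cite: BlaserIkenmeyerJindalLysikov2018, §5] -/
private theorem varCol_ne_varRow : ∀ a b : Fin 3, varCol a ≠ varRow b := by decide

/-- Clause rows are not variable rows. [cite: BlaserIkenmeyerJindalLysikov2018, §5] -/
private theorem clauseRow_ne_varRow : ∀ a b : Fin 3, clauseRow a ≠ varRow b := by decide

/-- Variable rows are not local-variable columns. [cite: BlaserIkenmeyerJindalLysikov2018, §5] -/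
private theorem varRow_ne_varCol : ∀ a b : Fin 3, varRow a ≠ varCol b := by decide

/-- Clause rows are not local-variable columns. [cite: BlaserIkenmeyerJindalLysikov2018, §5] -/
private theorem clauseRow_ne_varCol : ∀ a b : Fin 3, clauseRow a ≠ varCol b := by decide

/-- Variable rows are not clause rows. [cite: BlaserIkenmeyerJindalLysikov2018, §5] -/
private theorem varRow_ne_clauseRow : ∀ a b : Fin 3, varRow a ≠ clauseRow b := by decide

/-- `varRow` is injective. [cite: BlaserIkenmeyerJindalLysikov2018, §5] -/
private theorem varRow_inj : ∀ a b : Fin 3, varRow a = varRow b → a = b := by decide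

/-- `varCol` is injective. [cite: BlaserIkenmeyerJindalLysikov2018, §5] -/
private theorem varCol_inj : ∀ a b : Fin 3, varCol a = varCol b → a = b := by decide

/-! ### The pencil of `T_φ` at an arbitrary point -/

/-- The pencil entry, split along the three kinds of slices.
[cite: BlaserIkenmeyerJindalLysikov2018, §5 (construction of `T_φ`)] -/
theorem pencilEval_apply (φ : List (Clause₃ t)) (c : SliceIdx φ → K) (p q : Fin φ.length × Fin 9) :
    pencilEval (tphiA₀ K φ) (tphiSlices K φ) c p q =
      tphiA₀ K φ p q + (∑ x : Fin t, c (Sum.inl x) * tphiSlices K φ (Sum.inl x) p q) +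
        (∑ y : Fin φ.length × Fin 3 × Fin 3,
          c (Sum.inr (Sum.inl y)) * tphiSlices K φ (Sum.inr (Sum.inl y)) p q) +
        (∑ σ : (Σ x : Fin t, {pp : Occ φ x × Occ φ x // pp.1 ≠ pp.2}),
          c (Sum.inr (Sum.inr σ)) * tphiSlices K φ (Sum.inr (Sum.inr σ)) p q) := by
  simp only [pencilEval, Matrix.add_apply, Matrix.sum_apply, Matrix.smul_apply, smul_eq_mul]
  rw [Fintype.sum_sum_type, Fintype.sum_sum_type]
  simp only [add_assoc]

/-- The formula-variable slices vanish outside the variable rows.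
[cite: BlaserIkenmeyerJindalLysikov2018, §5 (construction of `T_φ`)] -/
theorem svar_eq_zero_of_row (φ : List (Clause₃ t)) (c : SliceIdx φ → K)
    (p q : Fin φ.length × Fin 9) (hp : ∀ a, p.2 ≠ varRow a) :
    (∑ x : Fin t, c (Sum.inl x) * tphiSlices K φ (Sum.inl x) p q) = 0 := by
  have e := Lemma22.svar_apply (K := K) φ (fun x => c (Sum.inl x)) p q
  beta_reduce at e
  rw [e]
  refine Finset.sum_eq_zero fun a _ => Finset.sum_eq_zero fun a' _ => ?_
  rw [if_neg fun h => hp a h.1]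

/-- The formula-variable slices vanish outside the local-variable columns.
[cite: BlaserIkenmeyerJindalLysikov2018, §5 (construction of `T_φ`)] -/
theorem svar_eq_zero_of_col (φ : List (Clause₃ t)) (c : SliceIdx φ → K)
    (p q : Fin φ.length × Fin 9) (hq : ∀ a, q.2 ≠ varCol a) :
    (∑ x : Fin t, c (Sum.inl x) * tphiSlices K φ (Sum.inl x) p q) = 0 := by
  have e := Lemma22.svar_apply (K := K) φ (fun x => c (Sum.inl x)) p q
  beta_reduce at e
  rw [e]
  refine Finset.sum_eq_zero fun a _ => Finset.sum_eq_zero fun a' _ => ?_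
  rw [if_neg fun h => hq a' h.2.1]

/-- On the diagonal position (variable row, local column) of one slot the formula-variable slices
contribute the value of the slot's variable. [cite: BlaserIkenmeyerJindalLysikov2018, §5] -/
theorem svar_diag (φ : List (Clause₃ t)) (c : SliceIdx φ → K) (j : Fin φ.length) (a : Fin 3) :
    (∑ x : Fin t, c (Sum.inl x) * tphiSlices K φ (Sum.inl x) (j, varRow a) (j, varCol a)) =
      c (Sum.inl ((φ.get j).lit a).1) := by
  have e := Lemma22.svar_apply (K := K) φ (fun x => c (Sum.inl x)) (j, varRow a) (j, varCol a)
  beta_reduce at e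
  rw [e]
  fin_cases a <;> simp +decide [Fin.sum_univ_three]

/-- The auxiliary slices vanish outside the variable rows.
[cite: BlaserIkenmeyerJindalLysikov2018, §5 (construction of `T_φ`)] -/
theorem saux_eq_zero_of_row (φ : List (Clause₃ t)) (c : SliceIdx φ → K)
    (p q : Fin φ.length × Fin 9) (hp : ∀ a, p.2 ≠ varRow a) :
    (∑ σ : (Σ x : Fin t, {pp : Occ φ x × Occ φ x // pp.1 ≠ pp.2}),
      c (Sum.inr (Sum.inr σ)) * tphiSlices K φ (Sum.inr (Sum.inr σ)) p q) = 0 := by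
  refine Finset.sum_eq_zero fun σ _ => ?_
  rw [Lemma22.tphiSlices_aux_apply, if_neg, mul_zero]
  rintro ⟨h, -⟩
  exact hp _ (congrArg Prod.snd h)

/-- The auxiliary slices vanish outside the local-variable columns.
[cite: BlaserIkenmeyerJindalLysikov2018, §5 (construction of `T_φ`)] -/
theorem saux_eq_zero_of_col (φ : List (Clause₃ t)) (c : SliceIdx φ → K)
    (p q : Fin φ.length × Fin 9) (hq : ∀ a, q.2 ≠ varCol a) :
    (∑ σ : (Σ x : Fin t, {pp : Occ φ x × Occ φ x // pp.1 ≠ pp.2}),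
      c (Sum.inr (Sum.inr σ)) * tphiSlices K φ (Sum.inr (Sum.inr σ)) p q) = 0 := by
  refine Finset.sum_eq_zero fun σ _ => ?_
  rw [Lemma22.tphiSlices_aux_apply, if_neg, mul_zero]
  rintro ⟨-, h⟩
  exact hq _ (congrArg Prod.snd h)

/-- The auxiliary slices `x_{h,ℓ}`, `h ≠ ℓ`, vanish at the diagonal position of a single slot.
[cite: BlaserIkenmeyerJindalLysikov2018, §5 (construction of `T_φ`)] -/
theorem saux_diag (φ : List (Clause₃ t)) (c : SliceIdx φ → K) (j : Fin φ.length) (a : Fin 3) :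
    (∑ σ : (Σ x : Fin t, {pp : Occ φ x × Occ φ x // pp.1 ≠ pp.2}),
      c (Sum.inr (Sum.inr σ)) * tphiSlices K φ (Sum.inr (Sum.inr σ)) (j, varRow a) (j, varCol a)) =
      0 := by
  refine Finset.sum_eq_zero fun σ _ => ?_
  rw [Lemma22.tphiSlices_aux_apply, if_neg, mul_zero]
  rintro ⟨h1, h2⟩
  apply σ.2.2
  simp only [Prod.mk.injEq] at h1 h2
  exact Subtype.ext (Prod.ext (h1.1.symm.trans h2.1)
    ((varRow_inj _ _ h1.2).symm.trans (varCol_inj _ _ h2.2)))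

/-- The local slices vanish on the variable rows.
[cite: BlaserIkenmeyerJindalLysikov2018, §5 (construction of `T_φ`)] -/
theorem sloc_eq_zero_varRow (φ : List (Clause₃ t)) (c : SliceIdx φ → K) (j : Fin φ.length)
    (b : Fin 3) (q : Fin φ.length × Fin 9) :
    (∑ y : Fin φ.length × Fin 3 × Fin 3,
      c (Sum.inr (Sum.inl y)) * tphiSlices K φ (Sum.inr (Sum.inl y)) (j, varRow b) q) = 0 := by
  have e := Lemma22.sloc_apply (K := K) φ (fun y => c (Sum.inr (Sum.inl y))) (j, varRow b) q
  beta_reduce at e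
  rw [e]
  split_ifs with h
  · refine Finset.sum_eq_zero fun a _ => Finset.sum_eq_zero fun wh _ => ?_
    simp [varRow_ne_varCol, varRow_ne_clauseRow]
  · rfl

/-- Off-block entries of the local-variable rows and the clause rows vanish.
[cite: BlaserIkenmeyerJindalLysikov2018, §5 (construction of `T_φ`)] -/
theorem pencil_offblock (φ : List (Clause₃ t)) (c : SliceIdx φ → K) (j j' : Fin φ.length)
    (i r' : Fin 9) (hj : j ≠ j') (hi : ∀ b, i ≠ varRow b) :
    pencilEval (tphiA₀ K φ) (tphiSlices K φ) c (j, i) (j', r') = 0 := by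
  rw [pencilEval_apply, svar_eq_zero_of_row φ c _ _ hi, saux_eq_zero_of_row φ c _ _ hi]
  have e := Lemma22.sloc_apply (K := K) φ (fun y => c (Sum.inr (Sum.inl y))) (j, i) (j', r')
  beta_reduce at e
  rw [e, if_neg (show ¬ ((j, i) : Fin φ.length × Fin 9).1 = (j', r').1 from hj)]
  simp [tphiA₀, hj]

/-- In-block entries of the local-variable row `(j, varCol a)` (printed row `2a+2` of gadget `j`:
`1, u` and `s(u) − u₁`). [cite: BlaserIkenmeyerJindalLysikov2018, §5 (clause gadget)] -/
theorem pencil_inblock_varCol (φ : List (Clause₃ t)) (c : SliceIdx φ → K) (j : Fin φ.length)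
    (a : Fin 3) (r' : Fin 9) :
    pencilEval (tphiA₀ K φ) (tphiSlices K φ) c (j, varCol a) (j, r') =
      (if r' = varRow a then 1 else 0) +
      (if r' = varCol a then c (Sum.inr (Sum.inl (j, a, 0))) else 0) +
      (if r' = clauseRow a then gs K ((φ.get j).lit a).2 (c (Sum.inr (Sum.inl (j, a, 0)))) -
          c (Sum.inr (Sum.inl (j, a, 1))) else 0) := by
  rw [pencilEval_apply, svar_eq_zero_of_row φ c _ _ (varCol_ne_varRow a),
    saux_eq_zero_of_row φ c _ _ (varCol_ne_varRow a)]
  have e := Lemma22.sloc_apply (K := K) φ (fun y => c (Sum.inr (Sum.inl y))) (j, varCol a) (j, r')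
  beta_reduce at e
  rw [e, if_pos rfl]
  simp only [tphiA₀, if_true, add_zero]
  fin_cases a <;> fin_cases r' <;> simp +decide [Fin.sum_univ_three, exists_fin3, gs] <;>
    (try split_ifs) <;> ring

/-- In-block entries of the clause row `(j, clauseRow 0)` (printed row `7`: `u − u₂, 1 − ℓ(u), 1`).
[cite: BlaserIkenmeyerJindalLysikov2018, §5 (clause gadget)] -/
theorem pencil_inblock_clauseRow0 (φ : List (Clause₃ t)) (c : SliceIdx φ → K) (j : Fin φ.length)
    (r' : Fin 9) :
    pencilEval (tphiA₀ K φ) (tphiSlices K φ) c (j, clauseRow 0) (j, r') =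
      (if r' = varCol 0 then c (Sum.inr (Sum.inl (j, 0, 0))) - c (Sum.inr (Sum.inl (j, 0, 2))) else 0) +
      (if r' = clauseRow 0 then 1 - gl K ((φ.get j).lit 0).2 (c (Sum.inr (Sum.inl (j, 0, 0)))) else 0) +
      (if r' = clauseRow 1 then 1 else 0) := by
  rw [pencilEval_apply, svar_eq_zero_of_row φ c _ _ (clauseRow_ne_varRow 0),
    saux_eq_zero_of_row φ c _ _ (clauseRow_ne_varRow 0)]
  have e := Lemma22.sloc_apply (K := K) φ (fun y => c (Sum.inr (Sum.inl y))) (j, clauseRow 0) (j, r')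
  beta_reduce at e
  rw [e, if_pos rfl]
  simp only [tphiA₀, if_true, add_zero]
  fin_cases r' <;> simp +decide [Fin.sum_univ_three, exists_fin3, gl] <;>
    (try split_ifs) <;> ring

/-- In-block entries of the clause row `(j, clauseRow 1)` (printed row `8`: `v − v₂, 1 − ℓ(v), 1`).
[cite: BlaserIkenmeyerJindalLysikov2018, §5 (clause gadget)] -/
theorem pencil_inblock_clauseRow1 (φ : List (Clause₃ t)) (c : SliceIdx φ → K) (j : Fin φ.length)
    (r' : Fin 9) :
    pencilEval (tphiA₀ K φ) (tphiSlices K φ) c (j, clauseRow 1) (j, r') =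
      (if r' = varCol 1 then c (Sum.inr (Sum.inl (j, 1, 0))) - c (Sum.inr (Sum.inl (j, 1, 2))) else 0) +
      (if r' = clauseRow 1 then 1 - gl K ((φ.get j).lit 1).2 (c (Sum.inr (Sum.inl (j, 1, 0)))) else 0) +
      (if r' = clauseRow 2 then 1 else 0) := by
  rw [pencilEval_apply, svar_eq_zero_of_row φ c _ _ (clauseRow_ne_varRow 1),
    saux_eq_zero_of_row φ c _ _ (clauseRow_ne_varRow 1)]
  have e := Lemma22.sloc_apply (K := K) φ (fun y => c (Sum.inr (Sum.inl y))) (j, clauseRow 1) (j, r')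
  beta_reduce at e
  rw [e, if_pos rfl]
  simp only [tphiA₀, if_true, add_zero]
  fin_cases r' <;> simp +decide [Fin.sum_univ_three, exists_fin3, gl] <;>
    (try split_ifs) <;> ring

/-- In-block entries of the clause row `(j, clauseRow 2)` (printed row `9`: `w − w₂, 1 − ℓ(w)`).
[cite: BlaserIkenmeyerJindalLysikov2018, §5 (clause gadget)] -/
theorem pencil_inblock_clauseRow2 (φ : List (Clause₃ t)) (c : SliceIdx φ → K) (j : Fin φ.length)
    (r' : Fin 9) :
    pencilEval (tphiA₀ K φ) (tphiSlices K φ) c (j, clauseRow 2) (j, r') =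
      (if r' = varCol 2 then c (Sum.inr (Sum.inl (j, 2, 0))) - c (Sum.inr (Sum.inl (j, 2, 2))) else 0) +
      (if r' = clauseRow 2 then 1 - gl K ((φ.get j).lit 2).2 (c (Sum.inr (Sum.inl (j, 2, 0)))) else 0) := by
  rw [pencilEval_apply, svar_eq_zero_of_row φ c _ _ (clauseRow_ne_varRow 2),
    saux_eq_zero_of_row φ c _ _ (clauseRow_ne_varRow 2)]
  have e := Lemma22.sloc_apply (K := K) φ (fun y => c (Sum.inr (Sum.inl y))) (j, clauseRow 2) (j, r')
  beta_reduce at e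
  rw [e, if_pos rfl]
  simp only [tphiA₀, if_true, add_zero]
  fin_cases r' <;> simp +decide [Fin.sum_univ_three, exists_fin3, gl] <;>
    (try split_ifs) <;> ring

/-! ### The row shapes fed to the rank core -/

/-- Variable row × variable column: the identity pattern of the constant slice.
[cite: BlaserIkenmeyerJindalLysikov2018, §5 (construction of `T_φ`)] -/
theorem pencil_varRow_varRow (φ : List (Clause₃ t)) (c : SliceIdx φ → K) (j : Fin φ.length)
    (a : Fin 3) (j' : Fin φ.length) (b : Fin 3) :
    pencilEval (tphiA₀ K φ) (tphiSlices K φ) c (j, varRow a) (j', varRow b) =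
      if (j', varRow b) = (j, varRow a) then 1 else 0 := by
  rw [pencilEval_apply, svar_eq_zero_of_col φ c _ _ (varRow_ne_varCol b),
    saux_eq_zero_of_col φ c _ _ (varRow_ne_varCol b), sloc_eq_zero_varRow]
  simp only [add_zero]
  by_cases hj : j = j'
  · subst hj
    fin_cases a <;> fin_cases b <;> simp +decide [tphiA₀, exists_fin3]
  · have hj' : j' ≠ j := fun h => hj h.symm
    simp [tphiA₀, hj, hj']

/-- Variable row × clause column: zero. [cite: BlaserIkenmeyerJindalLysikov2018, §5] -/
theorem pencil_varRow_clauseRow (φ : List (Clause₃ t)) (c : SliceIdx φ → K) (j : Fin φ.length)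
    (a : Fin 3) (j' : Fin φ.length) (b : Fin 3) :
    pencilEval (tphiA₀ K φ) (tphiSlices K φ) c (j, varRow a) (j', clauseRow b) = 0 := by
  rw [pencilEval_apply, svar_eq_zero_of_col φ c _ _ (clauseRow_ne_varCol b),
    saux_eq_zero_of_col φ c _ _ (clauseRow_ne_varCol b), sloc_eq_zero_varRow]
  simp only [add_zero]
  by_cases hj : j = j'
  · subst hj
    fin_cases a <;> fin_cases b <;> simp +decide [tphiA₀, exists_fin3]
  · simp [tphiA₀, hj]

/-- Variable row × own local column: the value of the slot's formula variable (`x`, `y`, `z`).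
[cite: BlaserIkenmeyerJindalLysikov2018, §5 (construction of `T_φ`)] -/
theorem pencil_varRow_varCol (φ : List (Clause₃ t)) (c : SliceIdx φ → K) (j : Fin φ.length)
    (a : Fin 3) :
    pencilEval (tphiA₀ K φ) (tphiSlices K φ) c (j, varRow a) (j, varCol a) =
      c (Sum.inl ((φ.get j).lit a).1) := by
  rw [pencilEval_apply, svar_diag, saux_diag, sloc_eq_zero_varRow]
  simp only [add_zero]
  fin_cases a <;> simp +decide [tphiA₀, exists_fin3]

/-- **Column support of the couplings**: the variable row of a slot meets the local column of
another slot only if the two slots carry the SAME formula variable ("there are only nonzero entries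
outside the gadget in the local columns `2, 4`, and `6` and rows `1, 3`, and `5`", and only between
occurrences of one variable). [cite: BlaserIkenmeyerJindalLysikov2018, §5 (construction of `T_φ`), Lemma 22 (proof)] -/
theorem pencil_varRow_varCol_eq_zero (φ : List (Clause₃ t)) (c : SliceIdx φ → K) (j : Fin φ.length)
    (a : Fin 3) (j' : Fin φ.length) (b : Fin 3) (hne : ((φ.get j).lit a).1 ≠ ((φ.get j').lit b).1) :
    pencilEval (tphiA₀ K φ) (tphiSlices K φ) c (j, varRow a) (j', varCol b) = 0 := by
  rw [pencilEval_apply, sloc_eq_zero_varRow]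
  have hsv : (∑ x : Fin t, c (Sum.inl x) * tphiSlices K φ (Sum.inl x) (j, varRow a) (j', varCol b)) = 0 := by
    have e := Lemma22.svar_apply (K := K) φ (fun x => c (Sum.inl x)) (j, varRow a) (j', varCol b)
    beta_reduce at e
    rw [e]
    refine Finset.sum_eq_zero fun a₁ _ => Finset.sum_eq_zero fun a' _ => ?_
    rw [if_neg]
    rintro ⟨h1, h2, h3⟩
    have e1 : a = a₁ := varRow_inj _ _ h1
    have e2 : b = a' := varCol_inj _ _ h2
    subst e1 e2
    exact hne h3.symm
  have hsa : (∑ σ : (Σ x : Fin t, {pp : Occ φ x × Occ φ x // pp.1 ≠ pp.2}),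
      c (Sum.inr (Sum.inr σ)) * tphiSlices K φ (Sum.inr (Sum.inr σ)) (j, varRow a) (j', varCol b)) =
      0 := by
    refine Finset.sum_eq_zero fun σ _ => ?_
    obtain ⟨x, ⟨⟨h, l⟩, -⟩⟩ := σ
    rw [Lemma22.tphiSlices_aux_apply, if_neg, mul_zero]
    rintro ⟨hp, hq⟩
    simp only [Prod.mk.injEq] at hp hq
    apply hne
    rw [hp.1, varRow_inj _ _ hp.2, hq.1, varCol_inj _ _ hq.2, h.2, l.2]
  rw [hsv, hsa]
  simp only [add_zero]
  by_cases hj : j = j'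
  · subst hj
    fin_cases a <;> fin_cases b <;> simp +decide [tphiA₀, exists_fin3]
  · simp [tphiA₀, hj]

/-- The local-variable row `(j, varCol a)` in full. [cite: BlaserIkenmeyerJindalLysikov2018, §5] -/
theorem pencil_row_varCol (φ : List (Clause₃ t)) (c : SliceIdx φ → K) (j : Fin φ.length)
    (a : Fin 3) (q : Fin φ.length × Fin 9) :
    pencilEval (tphiA₀ K φ) (tphiSlices K φ) c (j, varCol a) q =
      (if q = (j, varRow a) then 1 else 0) +
      (if q = (j, varCol a) then c (Sum.inr (Sum.inl (j, a, 0))) else 0) +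
      (if q = (j, clauseRow a) then gs K ((φ.get j).lit a).2 (c (Sum.inr (Sum.inl (j, a, 0)))) -
          c (Sum.inr (Sum.inl (j, a, 1))) else 0) := by
  obtain ⟨j', r'⟩ := q
  by_cases hj : j = j'
  · subst hj
    rw [pencil_inblock_varCol]
    simp only [Prod.mk.injEq, true_and]
  · have hj' : ¬ j' = j := fun h => hj h.symm
    rw [pencil_offblock φ c j j' _ r' hj (varCol_ne_varRow a)]
    simp [hj']

/-- The clause row `(j, clauseRow 0)` in full. [cite: BlaserIkenmeyerJindalLysikov2018, §5] -/
theorem pencil_row_clauseRow0 (φ : List (Clause₃ t)) (c : SliceIdx φ → K) (j : Fin φ.length)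
    (q : Fin φ.length × Fin 9) :
    pencilEval (tphiA₀ K φ) (tphiSlices K φ) c (j, clauseRow 0) q =
      (if q = (j, varCol 0) then c (Sum.inr (Sum.inl (j, 0, 0))) - c (Sum.inr (Sum.inl (j, 0, 2))) else 0) +
      (if q = (j, clauseRow 0) then 1 - gl K ((φ.get j).lit 0).2 (c (Sum.inr (Sum.inl (j, 0, 0)))) else 0) +
      (if q = (j, clauseRow 1) then 1 else 0) := by
  obtain ⟨j', r'⟩ := q
  by_cases hj : j = j'
  · subst hj
    rw [pencil_inblock_clauseRow0]
    simp only [Prod.mk.injEq, true_and]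
  · have hj' : ¬ j' = j := fun h => hj h.symm
    rw [pencil_offblock φ c j j' _ r' hj (clauseRow_ne_varRow 0)]
    simp [hj']

/-- The clause row `(j, clauseRow 1)` in full. [cite: BlaserIkenmeyerJindalLysikov2018, §5] -/
theorem pencil_row_clauseRow1 (φ : List (Clause₃ t)) (c : SliceIdx φ → K) (j : Fin φ.length)
    (q : Fin φ.length × Fin 9) :
    pencilEval (tphiA₀ K φ) (tphiSlices K φ) c (j, clauseRow 1) q =
      (if q = (j, varCol 1) then c (Sum.inr (Sum.inl (j, 1, 0))) - c (Sum.inr (Sum.inl (j, 1, 2))) else 0) +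
      (if q = (j, clauseRow 1) then 1 - gl K ((φ.get j).lit 1).2 (c (Sum.inr (Sum.inl (j, 1, 0)))) else 0) +
      (if q = (j, clauseRow 2) then 1 else 0) := by
  obtain ⟨j', r'⟩ := q
  by_cases hj : j = j'
  · subst hj
    rw [pencil_inblock_clauseRow1]
    simp only [Prod.mk.injEq, true_and]
  · have hj' : ¬ j' = j := fun h => hj h.symm
    rw [pencil_offblock φ c j j' _ r' hj (clauseRow_ne_varRow 1)]
    simp [hj']

/-- The clause row `(j, clauseRow 2)` in full. [cite: BlaserIkenmeyerJindalLysikov2018, §5] -/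
theorem pencil_row_clauseRow2 (φ : List (Clause₃ t)) (c : SliceIdx φ → K) (j : Fin φ.length)
    (q : Fin φ.length × Fin 9) :
    pencilEval (tphiA₀ K φ) (tphiSlices K φ) c (j, clauseRow 2) q =
      (if q = (j, varCol 2) then c (Sum.inr (Sum.inl (j, 2, 0))) - c (Sum.inr (Sum.inl (j, 2, 2))) else 0) +
      (if q = (j, clauseRow 2) then 1 - gl K ((φ.get j).lit 2).2 (c (Sum.inr (Sum.inl (j, 2, 0)))) else 0) := by
  obtain ⟨j', r'⟩ := q
  by_cases hj : j = j'
  · subst hj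
    rw [pencil_inblock_clauseRow2]
    simp only [Prod.mk.injEq, true_and]
  · have hj' : ¬ j' = j := fun h => hj h.symm
    rw [pencil_offblock φ c j j' _ r' hj (clauseRow_ne_varRow 2)]
    simp [hj']

/-! ### Rank consequences at a point `c` -/

/-- **`rk(A₀ + Σ c_k A_k) ≥ 5s` at every point.** [cite: BlaserIkenmeyerJindalLysikov2018, Lemma 22 (proof)] -/
theorem five_mul_length_le_rank_pencilEval (φ : List (Clause₃ t)) (c : SliceIdx φ → K) :
    5 * φ.length ≤ (pencilEval (tphiA₀ K φ) (tphiSlices K φ) c).rank :=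
  (tphiCore_five_mul_le_rank (pencilEval (tphiA₀ K φ) (tphiSlices K φ) c)
    (fun j a => c (Sum.inr (Sum.inl (j, a, 0))))
    (fun j a => gs K ((φ.get j).lit a).2 (c (Sum.inr (Sum.inl (j, a, 0)))) -
      c (Sum.inr (Sum.inl (j, a, 1))))
    (fun j a => c (Sum.inr (Sum.inl (j, a, 0))) - c (Sum.inr (Sum.inl (j, a, 2))))
    (fun j a => 1 - gl K ((φ.get j).lit a).2 (c (Sum.inr (Sum.inl (j, a, 0)))))
    (pencil_row_varCol φ c) (pencil_row_clauseRow0 φ c) (pencil_row_clauseRow1 φ c)).2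

/-- A `{0,1}`-value satisfying its literal, read through a Boolean assignment `σ` with
`σ(v) ⇔ c_v = 1`, makes the literal true. [cite: BlaserIkenmeyerJindalLysikov2018, Lemma 21] -/
theorem eval_of_satisfiesLit (φ : List (Clause₃ t)) (c : SliceIdx φ → K) (σ : Fin t → Bool)
    (hσ : ∀ v, σ v = true ↔ c (Sum.inl v) = 1) (l : Literal (Fin t))
    (h : SatisfiesLit K l.2 (c (Sum.inl l.1))) : Literal.eval σ l = true := by
  rcases h with ⟨h1, h2⟩ | ⟨h0, h2⟩
  · have hv : σ l.1 = true := (hσ _).2 h1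
    simp [Literal.eval, hv, h2]
  · have hv : σ l.1 = false := by simpa [h0] using hσ l.1
    simp [Literal.eval, hv, h2]

/-- **`rk(A₀ + Σ c_k A_k) ≤ 5s` at some point forces a satisfying assignment**, namely
`v ↦ [c_v = 1]`: by the rank core every block has `u = x, v = y, w = z` and
`(1−ℓ(x))(1−ℓ(y))(1−ℓ(z)) = 0`, and `1 − ℓ = 0` is satisfaction by a `{0,1}`-value (Lemma 21).
[cite: BlaserIkenmeyerJindalLysikov2018, Lemma 21 (2), Lemma 22 (proof)] -/
theorem exists_numSat₃_eq_length_of_rank_le (φ : List (Clause₃ t)) (c : SliceIdx φ → K)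
    (hr : (pencilEval (tphiA₀ K φ) (tphiSlices K φ) c).rank ≤ 5 * φ.length) :
    ∃ σ : Fin t → Bool, numSat₃ φ σ = φ.length := by
  classical
  refine ⟨fun v => decide (c (Sum.inl v) = 1), ?_⟩
  have hσ : ∀ v, (fun v => decide (c (Sum.inl v) = 1)) v = true ↔ c (Sum.inl v) = 1 :=
    fun v => decide_eq_true_iff
  unfold numSat₃
  rw [List.countP_eq_length]
  intro cl hcl
  obtain ⟨j, rfl⟩ := List.mem_iff_get.1 hcl
  have hcore := tphiCore_of_rank_le (pencilEval (tphiA₀ K φ) (tphiSlices K φ) c)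
    (fun j a => c (Sum.inl ((φ.get j).lit a).1))
    (fun j a => c (Sum.inr (Sum.inl (j, a, 0))))
    (fun j a => gs K ((φ.get j).lit a).2 (c (Sum.inr (Sum.inl (j, a, 0)))) -
      c (Sum.inr (Sum.inl (j, a, 1))))
    (fun j a => c (Sum.inr (Sum.inl (j, a, 0))) - c (Sum.inr (Sum.inl (j, a, 2))))
    (fun j a => 1 - gl K ((φ.get j).lit a).2 (c (Sum.inr (Sum.inl (j, a, 0)))))
    (pencil_varRow_varRow φ c) (pencil_varRow_clauseRow φ c) (pencil_varRow_varCol φ c)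
    (pencil_row_varCol φ c) (pencil_row_clauseRow0 φ c) (pencil_row_clauseRow1 φ c)
    (pencil_row_clauseRow2 φ c) hr j
  obtain ⟨hux, hg⟩ := hcore
  rw [hux 0, hux 1, hux 2] at hg
  have hlit : ∀ a : Fin 3, 1 - gl K ((φ.get j).lit a).2 (c (Sum.inl ((φ.get j).lit a).1)) = 0 →
      Literal.eval (fun v => decide (c (Sum.inl v) = 1)) ((φ.get j).lit a) = true :=
    fun a ha => eval_of_satisfiesLit φ c _ hσ _ (Lemma21.satisfiesLit_of_sub_gl_eq_zero _ _ ha)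
  have h0 : (φ.get j).lit 0 = (φ.get j).1 := by simp [Clause₃.lit]
  have h1 : (φ.get j).lit 1 = (φ.get j).2.1 := by simp [Clause₃.lit]
  have h2 : (φ.get j).lit 2 = (φ.get j).2.2 := by simp [Clause₃.lit]
  simp only [Bool.or_eq_true]
  rcases mul_eq_zero.1 hg with hg' | hg2
  · rcases mul_eq_zero.1 hg' with hg0 | hg1
    · exact Or.inl (Or.inl (h0 ▸ hlit 0 hg0))
    · exact Or.inl (Or.inr (h1 ▸ hlit 1 hg1))
  · exact Or.inr (h2 ▸ hlit 2 hg2)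

end Lemma22Safe

open Lemma22Safe

/-! ### The results -/

variable {t : ℕ}

variable (K) in
/-- **Lemma 22, safe reading (2′a): `CR(T_φ) ≥ 5s` for every 3-CNF `φ`** ("the local columns
`1, 3, 5, 8`, and `9` are linearly independent", a unitriangular `5s`-minor at every point).
[cite: BlaserIkenmeyerJindalLysikov2018, Lemma 22 (proof, ECCC p.16)] -/
theorem five_mul_length_le_completionRank_tphi (φ : List (Clause₃ t)) :
    5 * φ.length ≤ completionRank (tphiA₀ K φ) (tphiSlices K φ) := by
  obtain ⟨c, hc⟩ := exists_rank_pencilEval_eq_completionRank (tphiA₀ K φ) (tphiSlices K φ)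
  rw [← hc]
  exact five_mul_length_le_rank_pencilEval φ c

variable (K) in
/-- **Lemma 22, safe reading (2′b): `CR(T_φ) ≤ 5s` forces `φ` satisfiable** (an assignment
satisfying all `s` clauses). [cite: BlaserIkenmeyerJindalLysikov2018, Lemma 22 (2) (safe reading) and Lemma 21 (2)] -/
theorem exists_satisfying_of_completionRank_tphi_le (φ : List (Clause₃ t))
    (h : completionRank (tphiA₀ K φ) (tphiSlices K φ) ≤ 5 * φ.length) :
    ∃ σ : Fin t → Bool, numSat₃ φ σ = φ.length := by
  obtain ⟨c, hc⟩ := exists_rank_pencilEval_eq_completionRank (tphiA₀ K φ) (tphiSlices K φ)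
  exact exists_numSat₃_eq_length_of_rank_le φ c (hc.le.trans h)

variable (K) in
/-- **`CR(T_φ) ≤ 5s ⇔ φ` is satisfiable** (Lemma 22 (1), val-lit p2, with (2′b)).
[cite: BlaserIkenmeyerJindalLysikov2018, Lemma 22] -/
theorem completionRank_tphi_le_iff_satisfiable (φ : List (Clause₃ t)) :
    completionRank (tphiA₀ K φ) (tphiSlices K φ) ≤ 5 * φ.length ↔
      ∃ σ : Fin t → Bool, numSat₃ φ σ = φ.length :=
  ⟨exists_satisfying_of_completionRank_tphi_le K φ, completionRank_tphi_le_of_satisfiable K φ⟩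

variable (K) in
/-- **`CR(T_φ) = 5s ⇔ φ` is satisfiable**, by (2′a). [cite: BlaserIkenmeyerJindalLysikov2018, Lemma 22] -/
theorem completionRank_tphi_eq_iff_satisfiable (φ : List (Clause₃ t)) :
    completionRank (tphiA₀ K φ) (tphiSlices K φ) = 5 * φ.length ↔
      ∃ σ : Fin t → Bool, numSat₃ φ σ = φ.length := by
  rw [← completionRank_tphi_le_iff_satisfiable K φ, le_antisymm_iff,
    and_iff_left (five_mul_length_le_completionRank_tphi K φ)]

variable (K) in
/-- **Unsatisfiable `φ` have `CR(T_φ) ≥ 5s + 1`** (the exact, gap-free form of Lemma 22 (2)).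
[cite: BlaserIkenmeyerJindalLysikov2018, Lemma 22 (2) (safe reading)] -/
theorem five_mul_length_lt_completionRank_tphi_of_unsat (φ : List (Clause₃ t))
    (h : ∀ σ : Fin t → Bool, numSat₃ φ σ ≠ φ.length) :
    5 * φ.length < completionRank (tphiA₀ K φ) (tphiSlices K φ) := by
  refine lt_of_le_of_ne (five_mul_length_le_completionRank_tphi K φ) fun heq => ?_
  obtain ⟨σ, hσ⟩ := (completionRank_tphi_eq_iff_satisfiable K φ).1 heq.symm
  exact h σ hσ

variable (K) in
/-- **BIJL Lemma 22, safe reading — DISCHARGED** (`BIJL2018_lemma22_safe`: (1) satisfiable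
`⇒ CR(T_φ) ≤ 5s`; (2′a) `CR(T_φ) ≥ 5s`; (2′b) `CR(T_φ) = 5s ⇒` satisfiable).
[cite: BlaserIkenmeyerJindalLysikov2018, Lemma 22 (1) and proof of Lemma 22 (2), ECCC p.16; Lemma 21 (2)] -/
theorem BIJL2018_lemma22_safe_holds : BIJL2018_lemma22_safe K := fun _ φ =>
  ⟨completionRank_tphi_le_of_satisfiable K φ, five_mul_length_le_completionRank_tphi K φ,
    fun h => (completionRank_tphi_eq_iff_satisfiable K φ).1 h⟩

end Literature.Barriers.ValiantsHypothesis

end
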